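import Literature.NumberTheory.Automorphic.RamifiedPlaceIntegerInvolution   -- ★ the ramified place package (`exists_integer_involution_of_ramified`, `isUnit_two_integer_of_v_two_eq_one`, `isUnit_integer_of_v_eq_one`)
import Literature.NumberTheory.LocalFields.RamifiedQuadraticNormCriterion  -- ★ B-p10: the abstract tame-ramified norm criterion
import HarnessLib

/-!
# Unit norms at a TAMELY RAMIFIED quadratic place: `N(U_w) = {u ∈ U_v : ū ∈ 𝓀ˣ²}` has index `2`, and there are no anti-fixed units

[cite: Serre1979, Ch. V §3 Prop. 5, Cor. 2] [cite: LabesseLanglands1979, §2 pp. 8–9] [cite: Flicker1998UnitaryFL, Prop. 7 p. 84]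

Topic `NumberTheory/LocalFields`; namespace `Literature.NumberTheory.LocalFields.RamifiedPlaceUnitNorms`.  THEOREMS ONLY (no `def`, no named fact,
no instance, no notation).  Row «F-ram UNIT NORMS» of the S3-ram seeding wave (desk F0P3a-p06 (g15), LEAD T11-46 (1)): the RAMIFIED twin, in the
`galAdicCompletionMap` ∕ `Valued.v` currency, of the inert bottom-out lemma ★ `exists_mul_galAdicCompletionMap_eq_of_isUnramifiedIn` («at an unramified
non-split place every `σ_w`-fixed unit is a norm `t · σ_w t` of a unit»).

THE MATHEMATICS.  `E ∕ F` a quadratic extension of number fields with non-trivial automorphism `c`, `w ∣ v` a finite place with `c • w = w` which is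
RAMIFIED (`e(w|v) ≠ 1`) and TAME (`|2|_w = 1`); `σ_w = galAdicCompletionMap c hw` the conjugation of `E_w` over `F_v`.  Then `σ_w` is residually trivial on
`𝒪[E_w]` (★ `exists_integer_involution_of_ramified`), and Serre's computation of the norm group of a tamely, totally ramified quadratic extension
[Serre1979, V §3] — in the tree's abstract form ★ `RamifiedQuadraticNorm.exists_mul_map_eq_iff_isSquare_residue` (B-p10) — reads:
* (U1) `exists_mul_galAdicCompletionMap_eq_iff_isSquare_residue_of_ramified`: a `σ_w`-fixed unit `u` is a norm `t · σ_w t` of a unit `t` **iff its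
  residue is a square** in `𝓀_w = 𝓀_v`;
* (U2) `exists_fixed_unit_not_norm_of_ramified`: there IS a `σ_w`-fixed unit `η` with non-square residue, and it is not a norm `t · σ_w t` of ANY `t ∈ E_w`
  (so `[U_v : N U_w] = 2`, the residue quadratic character being the obstruction);
* (U3) `exists_mul_galAdicCompletionMap_eq_or_of_ramified`: for such an `η`, every `σ_w`-fixed unit `u` is `t · σ_w t` or `η · t · σ_w t` with `|t| = 1`
  (index at most `2`);
* (U4) `valued_lt_one_of_galAdicCompletionMap_eq_neg_of_ramified`: an ANTI-fixed integer (`σ_w x = −x`) lies in `𝔪_w` — there are NO anti-fixed units at a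
  tame ramified place (the twin of the inert ★ `exists_galAdicCompletionMap_eq_neg_valued_eq_one` is a non-existence: `σ_w x ≡ x (𝔪_w)` and `2 ∈ 𝒪ˣ`).
§2 gives the CM dresses (`L ∕ L⁺`, `c` = complex conjugation).

* (U5) `valued_sub_mul_galAdicCompletionMap_eq_one_of_not_isSquare_residue`: for a fixed unit `η` of non-square residue, `|η − σ_w(z)·z|_w = 1` for every
  `|z| ≤ 1` (the `hε` token of the RANK-ram row).

**Main results.** `exists_mul_galAdicCompletionMap_eq_iff_isSquare_residue_of_ramified`, `exists_fixed_unit_not_norm_of_ramified`,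
`exists_mul_galAdicCompletionMap_eq_or_of_ramified`, `valued_lt_one_of_galAdicCompletionMap_eq_neg_of_ramified`,
`valued_sub_mul_galAdicCompletionMap_eq_one_of_not_isSquare_residue` (+ `_complexConj` dresses).

## References
* [Serre1979] J.-P. Serre, *Local Fields*, GTM 67 (1979), Ch. V §3 Prop. 5 and Cor. 2.
* [LabesseLanglands1979] J.-P. Labesse, R. P. Langlands, *L-indistinguishability for SL(2)*, Canad. J. Math. 31 (1979), §2 pp. 8–9.
* [Flicker1998UnitaryFL] Y. Flicker, *Elementary proof of the fundamental lemma for a unitary group*, Canad. J. Math. 50 (1998), Prop. 7 p. 84.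
-/

set_option autoImplicit false

noncomputable section

open NumberField IsDedekindDomain ValuativeRel
open scoped ValuativeRel
open Literature.NumberTheory.Automorphic Literature.NumberTheory.Automorphic.UnitaryGroup

namespace Literature.NumberTheory.LocalFields.RamifiedPlaceUnitNorms

/-! ## §1 Generic quadratic `E ∕ F` -/

section Generic

variable {F : Type} (E : Type) [Field F] [NumberField F] [Field E] [NumberField E] [Algebra F E] [Algebra.IsQuadraticExtension F E]
  (c : E ≃ₐ[F] E) (hc : c ≠ 1) (v : HeightOneSpectrum (𝓞 F)) (w : PlacesOver E v) (hw : c • w.1 = w.1)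

omit [NumberField F] [Algebra.IsQuadraticExtension F E] in
/-- A norm `t · σ_w t` of unit valuation has `|t|_w = 1` (`σ_w` preserves `|·|_w`). [cite: Serre1979, Ch. V §3] -/
theorem valued_eq_one_of_mul_galAdicCompletionMap_valued_eq_one {t : w.1.adicCompletion E}
    (h : Valued.v (t * galAdicCompletionMap (L := E) c hw t) = 1) : Valued.v t = 1 := by
  rw [map_mul, valued_galAdicCompletionMap] at h
  rcases lt_trichotomy (Valued.v t) 1 with hlt | heq | hgt
  · exfalso
    have h1 : Valued.v t * Valued.v t < 1 := mul_lt_one_of_nonneg_of_lt_one_left zero_le hlt hlt.le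
    exact absurd h h1.ne
  · exact heq
  · exfalso
    have h1 : 1 < Valued.v t * Valued.v t := lt_of_lt_of_le hgt (le_mul_of_one_le_right' hgt.le)
    exact absurd h h1.ne'

include hc in
/-- **(U1) THE NORM CRITERION AT A TAME RAMIFIED PLACE** [Serre1979, V §3 Prop. 5 ∕ Cor. 2]: for `w ∣ v` non-split RAMIFIED (`e(w|v) ≠ 1`) and TAME (`|2|_w = 1`),
a `σ_w`-fixed `u` with `|u|_w = 1` is a norm `t · σ_w t` of a unit `t` **iff the residue of `u` is a square**.  (Ramified twin of the inert ★
`exists_mul_galAdicCompletionMap_eq_of_isUnramifiedIn`, where EVERY fixed unit is a norm.)  Proof: ★ `exists_integer_involution_of_ramified` (σ_w on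
`𝒪[E_w]` is a residually trivial involution) + ★ B-p10 `RamifiedQuadraticNorm.exists_mul_map_eq_iff_isSquare_residue`. [cite: Serre1979, Ch. V §3 Prop. 5, Cor. 2]
[cite: Flicker1998UnitaryFL, Prop. 7 p. 84] -/
theorem exists_mul_galAdicCompletionMap_eq_iff_isSquare_residue_of_ramified (he : v.asIdeal.ramificationIdx' w.1.asIdeal ≠ 1)
    (h2 : Valued.v (2 : w.1.adicCompletion E) = 1) {u : w.1.adicCompletion E} (hu1 : Valued.v u = 1)
    (hfix : galAdicCompletionMap (L := E) c hw u = u) :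
    (∃ t : w.1.adicCompletion E, Valued.v t = 1 ∧ t * galAdicCompletionMap (L := E) c hw t = u) ↔
      IsSquare (IsLocalRing.residue 𝒪[w.1.adicCompletion E] ⟨u, (v_le_one_iff_mem_integer u).1 hu1.le⟩) := by
  obtain ⟨σO, hσO, hσσ, hres, -⟩ := exists_integer_involution_of_ramified E c hc v w hw he
  have h2O := isUnit_two_integer_of_v_two_eq_one w.1 h2
  have huO : IsUnit (⟨u, (v_le_one_iff_mem_integer u).1 hu1.le⟩ : 𝒪[w.1.adicCompletion E]) := isUnit_integer_of_v_eq_one w.1 hu1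
  have hσuO : σO ⟨u, (v_le_one_iff_mem_integer u).1 hu1.le⟩ = ⟨u, (v_le_one_iff_mem_integer u).1 hu1.le⟩ :=
    Subtype.ext (by rw [hσO]; exact hfix)
  rw [← RamifiedQuadraticNorm.exists_mul_map_eq_iff_isSquare_residue σO hσσ hres h2O huO hσuO]
  constructor
  · rintro ⟨t, ht1, htu⟩
    refine ⟨⟨t, (v_le_one_iff_mem_integer t).1 ht1.le⟩, Subtype.ext ?_⟩
    rw [Subring.coe_mul, hσO]
    exact htu
  · rintro ⟨s, hs⟩
    have hsu : (s : w.1.adicCompletion E) * galAdicCompletionMap (L := E) c hw s = u := by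
      have h := congrArg (fun x : 𝒪[w.1.adicCompletion E] => (x : w.1.adicCompletion E)) hs
      simpa only [Subring.coe_mul, hσO] using h
    exact ⟨s, valued_eq_one_of_mul_galAdicCompletionMap_valued_eq_one E c v w hw (by rw [hsu, hu1]), hsu⟩

include hc in
/-- **(U2) A FIXED UNIT WHICH IS NOT A NORM** [Serre1979, V §3 Cor. 2; LabesseLanglands1979 §2]: at a tame ramified non-split place there is `η ∈ E_w` with
`|η|_w = 1`, `σ_w η = η`, NON-SQUARE residue, and `η ≠ t · σ_w t` for every `t ∈ E_w` — so `N(U_w)` has index `2` in the `σ_w`-fixed units.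
[cite: Serre1979, Ch. V §3 Cor. 2] [cite: LabesseLanglands1979, §2 pp. 8–9] -/
theorem exists_fixed_unit_not_norm_of_ramified (he : v.asIdeal.ramificationIdx' w.1.asIdeal ≠ 1)
    (h2 : Valued.v (2 : w.1.adicCompletion E) = 1) :
    ∃ η : w.1.adicCompletion E, ∃ hη1 : Valued.v η = 1, galAdicCompletionMap (L := E) c hw η = η ∧
      ¬ IsSquare (IsLocalRing.residue 𝒪[w.1.adicCompletion E] ⟨η, (v_le_one_iff_mem_integer η).1 hη1.le⟩) ∧
      ¬ ∃ t : w.1.adicCompletion E, t * galAdicCompletionMap (L := E) c hw t = η := by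
  obtain ⟨σO, hσO, hσσ, hres, -⟩ := exists_integer_involution_of_ramified E c hc v w hw he
  have h2O := isUnit_two_integer_of_v_two_eq_one w.1 h2
  obtain ⟨η, hηu, hση, hηsq, hηn⟩ := RamifiedQuadraticNorm.exists_fixed_isUnit_not_exists_mul_map_eq σO hσσ hres h2O
  have hη1 : Valued.v (η : w.1.adicCompletion E) = 1 := by
    obtain ⟨ηi, hηi⟩ := hηu.exists_right_inv
    have hle : ∀ x : 𝒪[w.1.adicCompletion E], Valued.v (x : w.1.adicCompletion E) ≤ 1 := fun x => (v_le_one_iff_mem_integer _).2 x.2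
    have hprod : Valued.v (η : w.1.adicCompletion E) * Valued.v (ηi : w.1.adicCompletion E) = 1 := by
      rw [← map_mul, ← Subring.coe_mul, hηi, Subring.coe_one, map_one]
    refine le_antisymm (hle η) (not_lt.1 fun hlt => ?_)
    have h1 : Valued.v (η : w.1.adicCompletion E) * Valued.v (ηi : w.1.adicCompletion E) < 1 :=
      mul_lt_one_of_nonneg_of_lt_one_left zero_le hlt (hle ηi)
    exact absurd hprod h1.ne
  refine ⟨η, hη1, by rw [← hσO, hση], ?_, ?_⟩
  · exact hηsq
  · rintro ⟨t, ht⟩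
    have ht1 : Valued.v t = 1 := valued_eq_one_of_mul_galAdicCompletionMap_valued_eq_one E c v w hw (by rw [ht, hη1])
    refine hηn ⟨⟨t, (v_le_one_iff_mem_integer t).1 ht1.le⟩, Subtype.ext ?_⟩
    rw [Subring.coe_mul, hσO]
    exact ht

include hc in
/-- **(U3) INDEX AT MOST TWO**: with `η` a `σ_w`-fixed unit of non-square residue, every `σ_w`-fixed unit `u` is `t · σ_w t` or `η · (t · σ_w t)` for a unit `t`.
[cite: Serre1979, Ch. V §3 Cor. 2] [cite: LabesseLanglands1979, §2 pp. 8–9] -/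
theorem exists_mul_galAdicCompletionMap_eq_or_of_ramified (he : v.asIdeal.ramificationIdx' w.1.asIdeal ≠ 1)
    (h2 : Valued.v (2 : w.1.adicCompletion E) = 1) {η : w.1.adicCompletion E} (hη1 : Valued.v η = 1)
    (hση : galAdicCompletionMap (L := E) c hw η = η)
    (hη : ¬ IsSquare (IsLocalRing.residue 𝒪[w.1.adicCompletion E] ⟨η, (v_le_one_iff_mem_integer η).1 hη1.le⟩))
    {u : w.1.adicCompletion E} (hu1 : Valued.v u = 1) (hfix : galAdicCompletionMap (L := E) c hw u = u) :
    ∃ t : w.1.adicCompletion E, Valued.v t = 1 ∧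
      (t * galAdicCompletionMap (L := E) c hw t = u ∨ η * (t * galAdicCompletionMap (L := E) c hw t) = u) := by
  obtain ⟨σO, hσO, hσσ, hres, -⟩ := exists_integer_involution_of_ramified E c hc v w hw he
  have h2O := isUnit_two_integer_of_v_two_eq_one w.1 h2
  have huO : IsUnit (⟨u, (v_le_one_iff_mem_integer u).1 hu1.le⟩ : 𝒪[w.1.adicCompletion E]) := isUnit_integer_of_v_eq_one w.1 hu1
  have hσuO : σO ⟨u, (v_le_one_iff_mem_integer u).1 hu1.le⟩ = ⟨u, (v_le_one_iff_mem_integer u).1 hu1.le⟩ :=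
    Subtype.ext (by rw [hσO]; exact hfix)
  have hσηO : σO ⟨η, (v_le_one_iff_mem_integer η).1 hη1.le⟩ = ⟨η, (v_le_one_iff_mem_integer η).1 hη1.le⟩ :=
    Subtype.ext (by rw [hσO]; exact hση)
  obtain ⟨s, hs⟩ := RamifiedQuadraticNorm.exists_mul_map_eq_or_eq_mul σO hσσ hres h2O hσηO hη huO hσuO
  have hsE : (s : w.1.adicCompletion E) * galAdicCompletionMap (L := E) c hw s = ((s * σO s : 𝒪[w.1.adicCompletion E]) : w.1.adicCompletion E) := by
    rw [Subring.coe_mul, hσO]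
  rcases hs with hs | hs
  · have hsu : (s : w.1.adicCompletion E) * galAdicCompletionMap (L := E) c hw s = u := by
      rw [hsE, hs]
    exact ⟨s, valued_eq_one_of_mul_galAdicCompletionMap_valued_eq_one E c v w hw (by rw [hsu, hu1]), Or.inl hsu⟩
  · have hsu : η * ((s : w.1.adicCompletion E) * galAdicCompletionMap (L := E) c hw s) = u := by
      have h := congrArg Subtype.val hs
      simp only [Subring.coe_mul, hσO] at h
      exact h
    refine ⟨s, valued_eq_one_of_mul_galAdicCompletionMap_valued_eq_one E c v w hw ?_, Or.inr hsu⟩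
    have h := congrArg Valued.v hsu
    rw [map_mul, hη1, one_mul, hu1] at h
    exact h

include hc in
/-- **(U4) NO ANTI-FIXED UNITS AT A TAME RAMIFIED PLACE**: if `|x|_w ≤ 1` and `σ_w x = −x` then `|x|_w < 1` (`σ_w x ≡ x (𝔪_w)` gives `2x ∈ 𝔪_w`, and `2` is a
unit).  The ramified counterpart of the inert ★ `exists_galAdicCompletionMap_eq_neg_valued_eq_one` is thus a NON-existence. [cite: Serre1979, Ch. V §3]
[cite: Flicker1998UnitaryFL, §6 p. 95] -/
theorem valued_lt_one_of_galAdicCompletionMap_eq_neg_of_ramified (he : v.asIdeal.ramificationIdx' w.1.asIdeal ≠ 1)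
    (h2 : Valued.v (2 : w.1.adicCompletion E) = 1) {x : w.1.adicCompletion E} (hx : Valued.v x ≤ 1)
    (hσx : galAdicCompletionMap (L := E) c hw x = -x) : Valued.v x < 1 := by
  obtain ⟨σO, hσO, hσσ, hres, -⟩ := exists_integer_involution_of_ramified E c hc v w hw he
  have h2O := isUnit_two_integer_of_v_two_eq_one w.1 h2
  set xO : 𝒪[w.1.adicCompletion E] := ⟨x, (v_le_one_iff_mem_integer x).1 hx⟩ with hxO
  have hσxO : σO xO = -xO := Subtype.ext (by rw [hσO, Subring.coe_neg]; exact hσx)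
  have hm : xO ∈ IsLocalRing.maximalIdeal 𝒪[w.1.adicCompletion E] := by
    have h := hres xO
    rw [hσxO, show -xO - xO = -(2 * xO) by ring, neg_mem_iff] at h
    exact (Ideal.unit_mul_mem_iff_mem _ h2O).1 h
  have hmem : xO ∈ IsLocalRing.maximalIdeal 𝒪[w.1.adicCompletion E] ↔ Valued.v (xO : w.1.adicCompletion E) < 1 := by
    rw [← IsLocalRing.residue_eq_zero_iff, residue_eq_zero_iff_valuation_lt_one, v_lt_one_iff_valuation_lt_one]
  exact hmem.1 hm

include hc in
/-- **(U5) `|η − σ_w(z)·z|_w = 1` FOR A NON-SQUARE-RESIDUE UNIT `η`** (the `hε` token of the RANK-ram row; `σ_w η = η` is not needed): at a ramified non-split place the residue of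
`σ_w(z)·z` (`|z| ≤ 1`) is `z̄²` (`σ̄_w = id`), so `η̄ − z̄² ≠ 0` when `η̄` is a non-square, i.e. `η − σ_w(z)·z` is a unit. [cite: Serre1979, Ch. V §3 Prop. 5]
[cite: LabesseLanglands1979, §2 pp. 8–9] -/
theorem valued_sub_mul_galAdicCompletionMap_eq_one_of_not_isSquare_residue (he : v.asIdeal.ramificationIdx' w.1.asIdeal ≠ 1)
    {η : w.1.adicCompletion E} (hη1 : Valued.v η = 1)
    (hns : ¬ IsSquare (IsLocalRing.residue 𝒪[w.1.adicCompletion E] ⟨η, (v_le_one_iff_mem_integer η).1 hη1.le⟩)) :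
    ∀ z : w.1.adicCompletion E, Valued.v z ≤ 1 → Valued.v (η - galAdicCompletionMap (L := E) c hw z * z) = 1 := by
  intro z hz
  obtain ⟨σO, hσO, hσσ, hres, -⟩ := exists_integer_involution_of_ramified E c hc v w hw he
  set zO : 𝒪[w.1.adicCompletion E] := ⟨z, (v_le_one_iff_mem_integer z).1 hz⟩ with hzO
  set ηO : 𝒪[w.1.adicCompletion E] := ⟨η, (v_le_one_iff_mem_integer η).1 hη1.le⟩ with hηO
  -- the integer `η − σ(z) z` and its residue `η̄ − z̄²`
  have hcoe : ((ηO - σO zO * zO : 𝒪[w.1.adicCompletion E]) : w.1.adicCompletion E) = η - galAdicCompletionMap (L := E) c hw z * z := by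
    rw [AddSubgroupClass.coe_sub, Subring.coe_mul, hσO]
  have hsq : IsLocalRing.residue 𝒪[w.1.adicCompletion E] (σO zO * zO) = IsLocalRing.residue 𝒪[w.1.adicCompletion E] zO ^ 2 := by
    rw [mul_comm]; exact RamifiedQuadraticNorm.residue_mul_map_eq_sq σO hres zO
  have hne : IsLocalRing.residue 𝒪[w.1.adicCompletion E] (ηO - σO zO * zO) ≠ 0 := by
    rw [map_sub, hsq, sub_ne_zero]
    intro h
    exact hns ⟨IsLocalRing.residue 𝒪[w.1.adicCompletion E] zO, by rw [h, sq]⟩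
  have hmem : ∀ x : 𝒪[w.1.adicCompletion E], x ∈ IsLocalRing.maximalIdeal 𝒪[w.1.adicCompletion E] ↔ Valued.v (x : w.1.adicCompletion E) < 1 := fun x => by
    rw [← IsLocalRing.residue_eq_zero_iff, residue_eq_zero_iff_valuation_lt_one, v_lt_one_iff_valuation_lt_one]
  have hnot : ¬ Valued.v (((ηO - σO zO * zO : 𝒪[w.1.adicCompletion E]) : w.1.adicCompletion E)) < 1 := fun hlt =>
    hne ((IsLocalRing.residue_eq_zero_iff _).2 ((hmem _).2 hlt))
  have hle : Valued.v (((ηO - σO zO * zO : 𝒪[w.1.adicCompletion E]) : w.1.adicCompletion E)) ≤ 1 := (v_le_one_iff_mem_integer _).2 (ηO - σO zO * zO).2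
  rw [← hcoe]
  exact le_antisymm hle (not_lt.1 hnot)

end Generic

/-! ## §2 CM dress (`L ∕ L⁺`, `c` = complex conjugation) -/

section CM

variable (L : Type) [Field L] [NumberField L] [IsCMField L] {v : HeightOneSpectrum (𝓞 ↥(maximalRealSubfield L))}
  (w : PlacesOver L v) (hw : IsCMField.complexConj L • w.1 = w.1)

/-- (U1) for a CM extension. [cite: Serre1979, Ch. V §3 Prop. 5, Cor. 2] -/
theorem exists_mul_galAdicCompletionMap_eq_iff_isSquare_residue_of_ramified_complexConj (he : v.asIdeal.ramificationIdx' w.1.asIdeal ≠ 1)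
    (h2 : Valued.v (2 : w.1.adicCompletion L) = 1) {u : w.1.adicCompletion L} (hu1 : Valued.v u = 1)
    (hfix : galAdicCompletionMap (L := L) (IsCMField.complexConj L) hw u = u) :
    (∃ t : w.1.adicCompletion L, Valued.v t = 1 ∧ t * galAdicCompletionMap (L := L) (IsCMField.complexConj L) hw t = u) ↔
      IsSquare (IsLocalRing.residue 𝒪[w.1.adicCompletion L] ⟨u, (v_le_one_iff_mem_integer u).1 hu1.le⟩) :=
  exists_mul_galAdicCompletionMap_eq_iff_isSquare_residue_of_ramified L (IsCMField.complexConj L) (IsCMField.complexConj_ne_one L) v w hw he h2 hu1 hfix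

/-- (U2) for a CM extension. [cite: Serre1979, Ch. V §3 Cor. 2] -/
theorem exists_fixed_unit_not_norm_of_ramified_complexConj (he : v.asIdeal.ramificationIdx' w.1.asIdeal ≠ 1)
    (h2 : Valued.v (2 : w.1.adicCompletion L) = 1) :
    ∃ η : w.1.adicCompletion L, ∃ hη1 : Valued.v η = 1, galAdicCompletionMap (L := L) (IsCMField.complexConj L) hw η = η ∧
      ¬ IsSquare (IsLocalRing.residue 𝒪[w.1.adicCompletion L] ⟨η, (v_le_one_iff_mem_integer η).1 hη1.le⟩) ∧
      ¬ ∃ t : w.1.adicCompletion L, t * galAdicCompletionMap (L := L) (IsCMField.complexConj L) hw t = η :=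
  exists_fixed_unit_not_norm_of_ramified L (IsCMField.complexConj L) (IsCMField.complexConj_ne_one L) v w hw he h2

/-- (U4) for a CM extension. [cite: Serre1979, Ch. V §3] -/
theorem valued_lt_one_of_galAdicCompletionMap_eq_neg_of_ramified_complexConj (he : v.asIdeal.ramificationIdx' w.1.asIdeal ≠ 1)
    (h2 : Valued.v (2 : w.1.adicCompletion L) = 1) {x : w.1.adicCompletion L} (hx : Valued.v x ≤ 1)
    (hσx : galAdicCompletionMap (L := L) (IsCMField.complexConj L) hw x = -x) : Valued.v x < 1 :=
  valued_lt_one_of_galAdicCompletionMap_eq_neg_of_ramified L (IsCMField.complexConj L) (IsCMField.complexConj_ne_one L) v w hw he h2 hx hσx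

/-- (U5) for a CM extension. [cite: Serre1979, Ch. V §3 Prop. 5] -/
theorem valued_sub_mul_galAdicCompletionMap_eq_one_of_not_isSquare_residue_complexConj (he : v.asIdeal.ramificationIdx' w.1.asIdeal ≠ 1)
    {η : w.1.adicCompletion L} (hη1 : Valued.v η = 1)
    (hns : ¬ IsSquare (IsLocalRing.residue 𝒪[w.1.adicCompletion L] ⟨η, (v_le_one_iff_mem_integer η).1 hη1.le⟩)) :
    ∀ z : w.1.adicCompletion L, Valued.v z ≤ 1 → Valued.v (η - galAdicCompletionMap (L := L) (IsCMField.complexConj L) hw z * z) = 1 :=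
  valued_sub_mul_galAdicCompletionMap_eq_one_of_not_isSquare_residue L (IsCMField.complexConj L) (IsCMField.complexConj_ne_one L) v w hw he hη1 hns

end CM

end Literature.NumberTheory.LocalFields.RamifiedPlaceUnitNorms

end
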